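import Mathlib

/-!
# Floor stability: a dissipation floor and an energy ceiling survive a small correction

Solo-blind programme for `AnomalousDissipation`, paper §24.28(5) / §24.31(8)(iv) (the final
contraction step of L3).  The exact steady state is `U + v` with `U` the approximate solution
and `v` the correction produced by the contraction.  What the zeroth law needs from `U + v` is
(a) a dissipation FLOOR `ν ‖∇(U+v)‖² ≥ ε' > 0` uniformly in the family and (b) an energy CEILING.
Both are elementary consequences of the triangle inequality once the correction is small in the
dissipation norm (`ν ‖∇v‖² ≤ η²` with `η < √ε`) and bounded in energy.  This file records the
inequalities in a general real normed group (`x` plays `∇U` or `U`, `y` plays `∇v` or `v`), so that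
the bookkeeping of the last step of L3 is kernel-checked and quotable.

Main statements:
* `norm_sub_norm_le_norm_add`      : `‖x‖ - ‖y‖ ≤ ‖x + y‖`;
* `sq_sub_le_norm_add_sq`          : `(‖x‖ - ‖y‖)^2 ≤ ‖x + y‖^2` when `‖y‖ ≤ ‖x‖`;
* `floor_stability`                : `ε ≤ ν‖x‖²`, `ν‖y‖² ≤ η²`, `0 ≤ η ≤ √ε` ⇒ `(√ε - η)² ≤ ν‖x+y‖²`;
* `floor_stability_half`           : with `η ≤ √ε / 2` the floor `ε/4` survives;
* `ceiling_stability`              : `‖x‖² ≤ E`, `‖y‖² ≤ D` ⇒ `‖x+y‖² ≤ 2E + 2D`;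
* `family_floor`, `family_ceiling` : the same along a family indexed by `ℕ`
                                     (uniform floor `ε/4`, uniform ceiling `2E+2D`);
* `correction_budget`              : `‖L_n⁻¹‖ ≤ C n^p` and residual `≤ R n^{-M}` with `M > p`
                                     put the correction under the `ε/16` budget for large `n`.
No analysis beyond `Real.sqrt`; no `sorry`.
-/

namespace Summit.AnomalousDissipation.AnomalousDissipation.Theorems

open Real

section NormedGroup

variable {F : Type*} [SeminormedAddCommGroup F]

/-- Reverse triangle inequality in the form used for floors: `‖x‖ - ‖y‖ ≤ ‖x + y‖`. -/
theorem norm_sub_norm_le_norm_add (x y : F) : ‖x‖ - ‖y‖ ≤ ‖x + y‖ := by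
  have h : ‖x‖ ≤ ‖x + y‖ + ‖y‖ := by
    simpa using norm_add_le (x + y) (-y)
  linarith

/-- Squared form: if the correction is not larger than the main term,
`(‖x‖ - ‖y‖)^2 ≤ ‖x + y‖^2`. -/
theorem sq_sub_le_norm_add_sq (x y : F) (hxy : ‖y‖ ≤ ‖x‖) :
    (‖x‖ - ‖y‖) ^ 2 ≤ ‖x + y‖ ^ 2 := by
  have h0 : 0 ≤ ‖x‖ - ‖y‖ := sub_nonneg.mpr hxy
  have h1 := norm_sub_norm_le_norm_add x y
  exact pow_le_pow_left₀ h0 h1 2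

/-- Energy ceiling survives: `‖x + y‖² ≤ 2‖x‖² + 2‖y‖²`, hence `≤ 2E + 2D`. -/
theorem ceiling_stability (x y : F) {E D : ℝ} (hx : ‖x‖ ^ 2 ≤ E) (hy : ‖y‖ ^ 2 ≤ D) :
    ‖x + y‖ ^ 2 ≤ 2 * E + 2 * D := by
  have h := norm_add_le x y
  have h0 : 0 ≤ ‖x + y‖ := norm_nonneg _
  have h2 : ‖x + y‖ ^ 2 ≤ (‖x‖ + ‖y‖) ^ 2 := pow_le_pow_left₀ h0 h 2
  nlinarith [norm_nonneg x, norm_nonneg y, sq_nonneg (‖x‖ - ‖y‖)]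

/-- FLOOR STABILITY.  If `ν ‖x‖² ≥ ε` (floor for the approximate state), the correction satisfies
`ν ‖y‖² ≤ η²` with `0 ≤ η ≤ √ε`, and `ν ≥ 0`, then `ν ‖x + y‖² ≥ (√ε - η)²`. -/
theorem floor_stability (x y : F) {ν ε η : ℝ} (hν : 0 ≤ ν) (hη : 0 ≤ η)
    (hηε : η ≤ Real.sqrt ε) (hfloor : ε ≤ ν * ‖x‖ ^ 2) (hcorr : ν * ‖y‖ ^ 2 ≤ η ^ 2) :
    (Real.sqrt ε - η) ^ 2 ≤ ν * ‖x + y‖ ^ 2 := by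
  -- work with a := √ν ‖x‖, b := √ν ‖y‖, s := √ν ‖x + y‖
  set r := Real.sqrt ν with hr
  have hr0 : 0 ≤ r := Real.sqrt_nonneg ν
  have hr2 : r ^ 2 = ν := by rw [hr, Real.sq_sqrt hν]
  have ha2 : (r * ‖x‖) ^ 2 = ν * ‖x‖ ^ 2 := by rw [mul_pow, hr2]
  have hb2 : (r * ‖y‖) ^ 2 = ν * ‖y‖ ^ 2 := by rw [mul_pow, hr2]
  have hs2 : (r * ‖x + y‖) ^ 2 = ν * ‖x + y‖ ^ 2 := by rw [mul_pow, hr2]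
  have ha0 : 0 ≤ r * ‖x‖ := mul_nonneg hr0 (norm_nonneg _)
  have hb0 : 0 ≤ r * ‖y‖ := mul_nonneg hr0 (norm_nonneg _)
  have hs0 : 0 ≤ r * ‖x + y‖ := mul_nonneg hr0 (norm_nonneg _)
  -- √ε ≤ a
  have hεa : Real.sqrt ε ≤ r * ‖x‖ := by
    have : Real.sqrt ε ≤ Real.sqrt ((r * ‖x‖) ^ 2) := Real.sqrt_le_sqrt (by rw [ha2]; exact hfloor)
    rwa [Real.sqrt_sq ha0] at this
  -- b ≤ η
  have hbη : r * ‖y‖ ≤ η := by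
    have h : (r * ‖y‖) ^ 2 ≤ η ^ 2 := by rw [hb2]; exact hcorr
    have h' : Real.sqrt ((r * ‖y‖) ^ 2) ≤ Real.sqrt (η ^ 2) := Real.sqrt_le_sqrt h
    rwa [Real.sqrt_sq hb0, Real.sqrt_sq hη] at h'
  -- a - b ≤ s
  have htri : r * ‖x‖ - r * ‖y‖ ≤ r * ‖x + y‖ := by
    have := norm_sub_norm_le_norm_add x y
    have := mul_le_mul_of_nonneg_left this hr0
    linarith [mul_sub r ‖x‖ ‖y‖]
  have hkey : Real.sqrt ε - η ≤ r * ‖x + y‖ := by linarith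
  have hk0 : 0 ≤ Real.sqrt ε - η := sub_nonneg.mpr hηε
  calc (Real.sqrt ε - η) ^ 2 ≤ (r * ‖x + y‖) ^ 2 := pow_le_pow_left₀ hk0 hkey 2
    _ = ν * ‖x + y‖ ^ 2 := hs2

/-- Convenient form: a correction of dissipation size `η ≤ √ε / 2` leaves the floor `ε / 4`. -/
theorem floor_stability_half (x y : F) {ν ε η : ℝ} (hν : 0 ≤ ν) (hε : 0 ≤ ε) (hη : 0 ≤ η)
    (hηε : η ≤ Real.sqrt ε / 2) (hfloor : ε ≤ ν * ‖x‖ ^ 2) (hcorr : ν * ‖y‖ ^ 2 ≤ η ^ 2) :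
    ε / 4 ≤ ν * ‖x + y‖ ^ 2 := by
  have hs : 0 ≤ Real.sqrt ε := Real.sqrt_nonneg ε
  have hηε' : η ≤ Real.sqrt ε := by linarith
  have h := floor_stability x y hν hη hηε' hfloor hcorr
  have h4 : ε / 4 ≤ (Real.sqrt ε - η) ^ 2 := by
    have h1 : Real.sqrt ε / 2 ≤ Real.sqrt ε - η := by linarith
    have h0 : 0 ≤ Real.sqrt ε / 2 := by linarith
    have h2 := pow_le_pow_left₀ h0 h1 2
    have hsq : (Real.sqrt ε / 2) ^ 2 = ε / 4 := by
      rw [div_pow, Real.sq_sqrt hε]; norm_num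
    linarith [hsq]
  linarith

/-- FAMILY FORM (the shape the zeroth law consumes).  Along a family indexed by `j : ℕ` with
viscosities `ν j ≥ 0`: if the approximate states have the dissipation floor `ε ≤ ν j ‖x j‖²` and the
corrections satisfy `ν j ‖y j‖² ≤ ε / 16` uniformly, then the exact states `x j + y j` have the
uniform floor `ε / 4`. -/
theorem family_floor (x y : ℕ → F) (ν : ℕ → ℝ) {ε : ℝ} (hε : 0 < ε) (hν : ∀ j, 0 ≤ ν j)
    (hfloor : ∀ j, ε ≤ ν j * ‖x j‖ ^ 2) (hcorr : ∀ j, ν j * ‖y j‖ ^ 2 ≤ ε / 16) :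
    ∃ ε' : ℝ, 0 < ε' ∧ ∀ j, ε' ≤ ν j * ‖x j + y j‖ ^ 2 := by
  refine ⟨ε / 4, by positivity, fun j => ?_⟩
  have hη : (0 : ℝ) ≤ Real.sqrt ε / 4 := by positivity
  have hηε : Real.sqrt ε / 4 ≤ Real.sqrt ε / 2 := by linarith [Real.sqrt_nonneg ε]
  have hc : ν j * ‖y j‖ ^ 2 ≤ (Real.sqrt ε / 4) ^ 2 := by
    have := hcorr j
    rw [div_pow, Real.sq_sqrt hε.le]; norm_num; linarith
  exact floor_stability_half (x j) (y j) (hν j) hε.le hη hηε (hfloor j) hc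

/-- FAMILY FORM of the ceiling: uniformly bounded energies of approximate states and corrections
give uniformly bounded energies of the exact states. -/
theorem family_ceiling (x y : ℕ → F) {E D : ℝ} (hE : ∀ j, ‖x j‖ ^ 2 ≤ E)
    (hD : ∀ j, ‖y j‖ ^ 2 ≤ D) : ∃ E' : ℝ, ∀ j, ‖x j + y j‖ ^ 2 ≤ E' :=
  ⟨2 * E + 2 * D, fun j => ceiling_stability (x j) (y j) (hE j) (hD j)⟩

/-- The smallness the contraction must deliver, read backwards: to keep the floor `ε/4` it suffices
that the correction's dissipation is `≤ ε/16`; with `‖L_n⁻¹‖ ≤ C n^p` and a residual `≤ R n^{-M}`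
the correction has dissipation-norm `≤ C R n^{p-M}`, so `M > p` and `n` large suffice.  Recorded as the
elementary real-number implication it is (all quantities nonnegative). -/
theorem correction_budget {C R ε : ℝ} {p M : ℕ} (hC : 0 ≤ C) (hR : 0 ≤ R) (hε : 0 < ε)
    (hMp : p < M) :
    ∃ n₀ : ℕ, ∀ n : ℕ, n₀ ≤ n → (C * R) * ((n : ℝ) ^ p / (n : ℝ) ^ M) ≤ ε / 16 := by
  -- (n^p / n^M) = 1 / n^(M-p) ≤ 1/n for n ≥ 1; choose n₀ with C R / n₀ ≤ ε/16.
  obtain ⟨n₀, hn₀⟩ := exists_nat_gt (16 * (C * R) / ε)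
  refine ⟨n₀ + 1, fun n hn => ?_⟩
  have hn1 : (1 : ℝ) ≤ n := by exact_mod_cast (Nat.succ_le_iff.mp (by omega) : 1 ≤ n)
  have hnpos : (0 : ℝ) < n := by linarith
  have hratio : (n : ℝ) ^ p / (n : ℝ) ^ M ≤ 1 / n := by
    rw [div_le_div_iff₀ (by positivity) hnpos]
    have : (n : ℝ) ^ p * n = (n : ℝ) ^ (p + 1) := by ring
    rw [this, one_mul]
    exact pow_le_pow_right₀ hn1 (by omega)
  have hCR : 0 ≤ C * R := mul_nonneg hC hR
  have h1 : (C * R) * ((n : ℝ) ^ p / (n : ℝ) ^ M) ≤ (C * R) * (1 / n) :=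
    mul_le_mul_of_nonneg_left hratio hCR
  have hn₀' : (16 * (C * R) / ε) < n := by
    have : (n₀ : ℝ) + 1 ≤ n := by exact_mod_cast hn
    linarith
  have h2 : (C * R) * (1 / (n : ℝ)) ≤ ε / 16 := by
    rw [mul_one_div, div_le_div_iff₀ hnpos (by norm_num : (0:ℝ) < 16)]
    have := (div_lt_iff₀ hε).mp hn₀'
    nlinarith
  linarith

end NormedGroup

end Summit.AnomalousDissipation.AnomalousDissipation.Theorems
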